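import Literature.Analysis.FluidPDE.SteadyLiouvilleNineHalves
import Literature.Analysis.FluidPDE.SteadyLiouvilleCriteriaProofs
import Literature.Analysis.FluidPDE.SteadyStrainedNS
import HarnessLib

/-!
# Galdi's `L^{9/2}` Liouville theorem for steady D-solutions — discharge of `Galdi2011_thmX95`

Discharge of the named fact `Literature.Analysis.FluidPDE.Galdi2011_thmX95`
(`SteadyLiouvilleNineHalves.lean`): for `ν > 0`, a smooth steady solution `(v, P)` of the unforced
stationary Navier–Stokes system on `ℝ³` — rendered as the time-constant classical solution
`IsClassicalNSSolutionOn univ ν 0 (fun _ => v) (fun _ => P)` — with `v → 0` at infinity, finite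
Dirichlet integral `∫ ‖Dv‖² < ∞` and `v ∈ L^{9/2}(ℝ³)` vanishes identically (G. P. Galdi, *An
Introduction to the Mathematical Theory of the Navier–Stokes Equations. Steady-State Problems*,
2nd ed. (2011), Theorem X.9.5, p. 729; locator confirmed on the held text of Chae–Wolf,
arXiv:1604.07643, p. 3: "the condition `v ∈ L^{9/2}(ℝ³)` implies that `v = 0` (see Theorem X.9.5,
pp. 729 [Galdi])"). Main result: `Galdi2011_thmX95_holds`.

## Proof

The analytic content is ALREADY PROVED in the tree, along the printed route (test the system with
`φ_R u`, Calderón–Zygmund pressure `RᵢRⱼ(uᵢuⱼ) ∈ L^{9/4}`, Hölder on annuli, `R → ∞`): the named fact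
`galdi_liouville_nineHalves` (`SteadyLiouvilleCriteria.lean`, every `ν > 0`, steady solutions in the
profile class `IsLerayProfile ν 0 U P`, Dirichlet integral as `∫⁻ ofReal (frobeniusNormSq (DU)) < ∞`)
is discharged by `galdi_liouville_nineHalves_holds` (`SteadyLiouvilleCriteriaProofs.lean`). This file
only transports hypotheses between the two typings:

* `IsClassicalNSSolutionOn.isLerayProfile_zero_of_steady` — a time-constant classical solution of
  the unforced system on the time set `univ` is a Leray profile at rate `a = 0` (the slices are
  `C^∞`, the one-sided time derivative of a constant field vanishes (`timeDerivWithin_const`,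
  `SteadyStrainedNS.lean`), and the momentum equation `(v·∇)v = νΔv − ∇P` is the profile equation
  `−νΔv + 0•v + 0•Dv[y] + (v·∇)v + ∇P = 0`);
* `lintegral_frobeniusNormSq_fderiv_lt_top_of_integrable_norm_sq` — `|L|²_F ≤ 3‖L‖²` on `ℝ³`
  (three columns of norm `≤ ‖L‖`; the tree's `sum_sq_norm_apply_le_card_mul_sq_opNorm`), so
  integrability of `‖Dv‖²` (operator norm) gives a finite Frobenius Dirichlet integral.

No new definitions, no named facts.

## References

* [Galdi2011] G. P. Galdi, Springer Monographs in Mathematics (2011), Thm. X.9.5, p. 729.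
* D. Chae, J. Wolf, J. Differential Equations 261 (2016) 5541–5560 = arXiv:1604.07643, p. 3.
-/

noncomputable section

namespace Literature.Analysis.FluidPDE

open _root_.MeasureTheory _root_.Filter Set
open scoped _root_.Topology _root_.ENNReal

section Bridge

variable {E : Type*} [NormedAddCommGroup E] [InnerProductSpace ℝ E] [FiniteDimensional ℝ E]

/-- **Steady classical solutions are Leray profiles at rate `0`.** If the time-constant fields
`(fun _ => v, fun _ => P)` form a classical solution of the unforced Navier–Stokes system with
viscosity `ν` on the time set `univ` (`IsClassicalNSSolutionOn`, Fefferman (1)–(2), (6)), then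
`(v, P)` solves Leray's profile system at rate `a = 0`, i.e. the steady system
`−νΔv + (v·∇)v + ∇P = 0`, `div v = 0` with `v ∈ C²`, `P ∈ C¹` (`IsLerayProfile ν 0 v P`): the time
derivative of a constant field is `0`. [folklore] -/
theorem IsClassicalNSSolutionOn.isLerayProfile_zero_of_steady {ν : ℝ} {v : E → E} {P : E → ℝ}
    (h : IsClassicalNSSolutionOn (univ : Set ℝ) ν (fun _ _ => 0) (fun _ => v) (fun _ => P)) :
    IsLerayProfile ν 0 v P where
  contDiff_velocity := (h.contDiff_velocity (mem_univ (0 : ℝ))).of_le (by norm_cast)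
  contDiff_pressure := (h.contDiff_pressure (mem_univ (0 : ℝ))).of_le (by norm_cast)
  profile_eq y := by
    have hm := h.momentum 0 (mem_univ (0 : ℝ)) y
    simp only [timeDerivWithin_const, zero_add, add_zero] at hm
    rw [hm, zero_smul, zero_smul, add_zero, add_zero]
    abel
  divFree := h.divFree 0 (mem_univ (0 : ℝ))

end Bridge

/-- A field on `ℝ³` whose derivative has integrable squared operator norm, `∫ ‖Dv‖² < ∞`, has a
finite Frobenius Dirichlet integral `∫⁻ ofReal |Dv|²_F < ∞`: in the standard frame
`|L|²_F = ∑ᵢ ‖L eᵢ‖² ≤ 3‖L‖²` (`frobeniusNormSq_eq_sum`, `sum_sq_norm_apply_le_card_mul_sq_opNorm`),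
so the two densities differ by a factor at most `3`. [folklore] -/
theorem lintegral_frobeniusNormSq_fderiv_lt_top_of_integrable_norm_sq
    {v : EuclideanSpace ℝ (Fin 3) → EuclideanSpace ℝ (Fin 3)}
    (hI : Integrable (fun y => ‖fderiv ℝ v y‖ ^ 2) (volume : Measure (EuclideanSpace ℝ (Fin 3)))) :
    ∫⁻ x, ENNReal.ofReal (frobeniusNormSq (fderiv ℝ v x)) < ∞ := by
  have hF : ∀ x, frobeniusNormSq (fderiv ℝ v x) ≤ 3 * ‖fderiv ℝ v x‖ ^ 2 := fun x => by
    rw [frobeniusNormSq_eq_sum (EuclideanSpace.basisFun (Fin 3) ℝ)]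
    simpa using
      sum_sq_norm_apply_le_card_mul_sq_opNorm (EuclideanSpace.basisFun (Fin 3) ℝ) (fderiv ℝ v x)
  have h3 : Integrable (fun y => 3 * ‖fderiv ℝ v y‖ ^ 2)
      (volume : Measure (EuclideanSpace ℝ (Fin 3))) := hI.const_mul 3
  calc ∫⁻ x, ENNReal.ofReal (frobeniusNormSq (fderiv ℝ v x))
      ≤ ∫⁻ x, ENNReal.ofReal (3 * ‖fderiv ℝ v x‖ ^ 2) :=
        lintegral_mono fun x => ENNReal.ofReal_le_ofReal (hF x)
    _ ≤ ∫⁻ x, ‖3 * ‖fderiv ℝ v x‖ ^ 2‖ₑ := lintegral_ofReal_le_lintegral_enorm _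
    _ < ∞ := hasFiniteIntegral_iff_enorm.1 h3.hasFiniteIntegral

/-- **Galdi's `L^{9/2}` Liouville theorem for steady D-solutions, proved** (Galdi 2011,
Thm. X.9.5, p. 729; quoted in Chae–Wolf, arXiv:1604.07643, p. 3): discharge of the named fact
`Galdi2011_thmX95`. For `ν > 0`, a smooth steady solution `(v, P)` of the unforced stationary
Navier–Stokes system on `ℝ³` (time-constant `IsClassicalNSSolutionOn univ ν 0`) with `v → 0` at
infinity, `∫ ‖Dv‖² < ∞` and `v ∈ L^{9/2}(ℝ³)` is identically zero. Proof: the steady classical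
solution is a Leray profile at rate `0` (`IsClassicalNSSolutionOn.isLerayProfile_zero_of_steady`),
its Frobenius Dirichlet integral is finite
(`lintegral_frobeniusNormSq_fderiv_lt_top_of_integrable_norm_sq`), and the tree's proof of Galdi's
criterion in the profile class, `galdi_liouville_nineHalves_holds` (Calderón–Zygmund pressure in
`L^{9/4}`, Caccioppoli inequality, Hölder on annuli — the printed argument), applies. [cite: Galdi2011, Thm X.9.5 (p. 729)] -/
theorem Galdi2011_thmX95_holds : Galdi2011_thmX95 := by
  intro ν v P hν hsol hdecay hDir h92
  exact galdi_liouville_nineHalves_holds ν hν v P hsol.isLerayProfile_zero_of_steady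
    (lintegral_frobeniusNormSq_fderiv_lt_top_of_integrable_norm_sq hDir) hdecay h92

end Literature.Analysis.FluidPDE

end
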